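import Summits.Ventures.HSemireg.WedgeWeilDegRank

/-!
# Venture HSemireg — MOD-4 line: the MIXED part of THEOREM R_f's middle degree in th-7's wedge model
# (`dim (Mm_n ∧ v) = (C(2n,n) − 2)·r_n` for every `n ≥ 1`, every `q`, every field — family (a) of the proof sheet §4)

HONEST FRAMING. Part of the Lean index of the computation cell `pub-hsemireg` (widening group W3, seat w3-mod4-1 gen 5; files
of record `HOME/widen/W3/MOD4-OFFSPLIT-w3mod4.md` §10.2 / §11, `MOD4-THEOREM-RF-PROOF-w3mod4.md` v1.0 §4 (a)).  Finite-dimensional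
exterior algebra over a field ONLY (th-7's sign-free transposed wedge model `Summit.Ventures.HSemireg.Wedge`, files `Wedge*.lean`
enclosed by p3/p6): no abelian variety, no sheaf, no Ext group, no semiregularity map; nothing here says that HC, HC_CM or HC_AV
holds; no Literature fact is declared or used; THEOREM R_f is NOT asserted here.  WHAT IS PROVED: in the Weil model of type
`(n,n)` (`N = n + n` pairs; `v = vW K (n+n) n q a b = w_{2n}(q) + a·E_{Gm} + b·E_{Dm}`, th-7's `Wedge.Weil.vW`), the MIXED degree-`n`
forms `Mm K (n+n) n n` (monomials meeting both generator blocks) satisfy, for EVERY `q : ℕ → K` and every `a, b` (zero allowed):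
* `map_mulRight_vW_Mm` — `Mm_n ∧ v = Mm_n ∧ f` (mixed forms kill both block monomials: th-7's `mul_blocks_eq_zero_of_mem_Mm`,
  which carries no degree hypothesis);
* `finrank_map_vW_Mm_middle` — **`dim(Mm_n ∧ v) = (C(2n,n) − 2)·rank H_n(q)`** (th-7's `finrank_map_f_Mm` + `card_MXm`, both
  hypothesis-free in the degree) — the contribution `r_n(C(2n,n) − 2)` of family (a) («C = ∅ and S meets both halves») to `R_n`
  in the proof sheet §4.
So the middle degree `R_n = rank(∧v ∣ ⋀ⁿ)` decomposes as this mixed part plus the contribution of the forms supported in ONE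
block (families (b)/(b′)/(c)/(c′) of the sheet: the tags and the coupled block `U`, the latter kernel-checked abstractly in
`Mod4SiteUBlock.lean`); the direct-sum bookkeeping between these pieces is the part of §4 that remains pencil (MOD4-OFFSPLIT §11).
All statements and proofs: w3-mod4-1 g5 (2026-08-23).  Namespace `Summit.Ventures.HSemireg.Mod4Site`.
-/

namespace Summit.Ventures.HSemireg.Mod4Site

open Module Summit.Ventures.HSemireg.Wedge Summit.Ventures.HSemireg.Wedge.Hankel Summit.Ventures.HSemireg.Wedge.Weil

variable {K : Type*} [Field K]

/-- on mixed forms `θ ∧ v = θ ∧ f`: the images of `Mm` under `∧v` and under `∧f` coincide (any degree `m`, any `a, b`). -/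
theorem map_mulRight_vW_Mm {N m p : ℕ} (q : ℕ → K) (a b : K) :
    (Mm K N m p).map (LinearMap.mulRight K (vW K N p q a b)) = (Mm K N m p).map (LinearMap.mulRight K (w K N N q)) := by
  have key : ∀ θ ∈ Mm K N m p, θ * vW K N p q a b = θ * w K N N q := by
    intro θ hθ
    obtain ⟨h1, h2⟩ := mul_blocks_eq_zero_of_mem_Mm K hθ
    rw [vW_mul_expand, h1, h2, smul_zero, smul_zero, add_zero, add_zero]
  apply le_antisymm
  · rintro _ ⟨θ, hθ, rfl⟩
    exact ⟨θ, hθ, by rw [LinearMap.mulRight_apply, LinearMap.mulRight_apply, key θ hθ]⟩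
  · rintro _ ⟨θ, hθ, rfl⟩
    exact ⟨θ, hθ, by rw [LinearMap.mulRight_apply, LinearMap.mulRight_apply, key θ hθ]⟩

/-- **THE MIXED PART OF THE MIDDLE DEGREE** (family (a) of the proof sheet §4): in the Weil model of type `(n,n)`, `n ≥ 1`,
`dim(Mm_n ∧ v) = (C(2n,n) − 2)·rank H_n(q)` for every `q`, `a`, `b`. -/
theorem finrank_map_vW_Mm_middle {n : ℕ} (hn : 1 ≤ n) (q : ℕ → K) (a b : K) :
    Module.finrank K ↥((Mm K (n + n) n n).map (LinearMap.mulRight K (vW K (n + n) n q a b))) =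
      ((n + n).choose n - 2) * (hankel1 K (n + n) n q).rank := by
  rw [map_mulRight_vW_Mm, finrank_map_f_Mm K q]
  have h := card_MXm (N := n + n) (m := n) (p := n) hn (by omega)
  rw [Nat.add_sub_cancel_left, Nat.choose_self] at h
  congr 1
  omega

/-- the sixfold case `n = 3`: `dim(Mm₃ ∧ v) = 18·r₃` (= `54` on the carrier, `36` for two slopes, `18` for one slope). -/
example (q : ℕ → K) (a b : K) :
    Module.finrank K ↥((Mm K (3 + 3) 3 3).map (LinearMap.mulRight K (vW K (3 + 3) 3 q a b))) =
      18 * (hankel1 K (3 + 3) 3 q).rank := by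
  rw [finrank_map_vW_Mm_middle (by norm_num) q a b]
  rfl

end Summit.Ventures.HSemireg.Mod4Site
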